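import Summits.MatrixMultiplication.MatrixMultiplication.Theses.SnSubsetDichotomy

/-!
# Stub stub_urnBound (crux stmt-MatrixMultiplication-8303, line young-host-squeeze)

Crux `Summit.MatrixMultiplication.MatrixMultiplication.Theses.SnSubsetDichotomy.GlobalBranch`, line
`young-host-squeeze`, stub `stub_urnBound`: the ONE-ROW URN BOUND (multivariate-hypergeometric
anti-concentration) fed into the row-peeling induction of the Young double-coset squeeze.
Fix `1/2 ≤ θ < 2/3`.  For `n ≥ n₁(θ)`: an urn of `N` balls, `n/2 ≤ N ≤ n`, in colour classes
`c_j ≤ n^θ` (`Σ c_j = N`), and a histogram `e_j` with `Σ e_j = b ≤ n^θ`; then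
`∏_j C(c_j, e_j) ≤ exp(-b·n^{1-2θ}/16)·C(N, b)`.

Proof (`A = n^θ`, `T = n^{1-2θ} ∈ (0,1]`, `A²T = n`, `M = N + 1 - b ≥ n/4`).
`C(c_j,e_j) ≤ c_j^{e_j}/e_j!` (`Nat.choose_le_pow_div`) and `M^b/b! ≤ C(N,b)` (`Nat.pow_le_choose`)
reduce the claim to `P·b! ≤ e^{-Tb/16} M^b`, `P = ∏_j c_j^{e_j}/e_j!` (`urnBound_core`).
* SMALL ROWS `8Ab ≤ n` (`urnBound_small`): `P·b! ≤ A^b b^b ≤ (n/8)^b ≤ (e^{-T/16} n/4)^b`.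
* LARGE ROWS `n < 8Ab` (`urnBound_large`): with `ν_j = b c_j/M ∈ [0, 4/T]`, `Σ ν_j = bN/M`,
  `P = (M/b)^b ∏_j ν_j^{e_j}/e_j!`; the Poisson point-probability bound
  `ν^k/k! ≤ exp(ν - min(ν,1)/2)` for every `k` (`urnBound_pow_div_factorial_le`: `e·y ≤ e^y` and
  Stirling's lower bound `k! ≥ √(2πk)(k/e)^k`, Mathlib `Stirling.le_factorial_stirling`) with
  `min(ν,1) ≥ νT/4` gives `∏_j ν_j^{e_j}/e_j! ≤ exp((1 - T/8) bN/M)`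
  (`urnBound_prod_pow_div_factorial_le`); the upper Stirling bound `b! ≤ exp(1 + ½log b - b) b^b`
  (`urnBound_factorial_le_exp`, Mathlib `Stirling.stirlingSeq'_antitone`); and the bookkeeping
  `(1 - T/8) bN/M + 1 + ½ log b - b ≤ -Tb/16` (`urnBound_exponent`: `b(N-M)/M ≤ 4Ab/n ≤ Tb/32` as
  `128 A ≤ nT`, and `1 + ½ log b ≤ log n ≤ nT/(256A) < Tb/32`).
* `n₁(θ)` (`urnBound_eventually`): `n ≥ 64`, `n^{1-θ} ≥ 4`, `n^{2-3θ} ≥ 128`,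
  `256 log n ≤ n^{2-3θ}` (Mathlib `isLittleO_log_rpow_atTop`, `tendsto_rpow_atTop`).
-/

set_option linter.dupNamespace false

open scoped BigOperators Classical Nat
open Finset Real

namespace Summit.MatrixMultiplication.MatrixMultiplication.Theorems.GlobalBranch

/-! ### Poisson point probabilities and Stirling -/

/-- **Poisson point probabilities.** For `ν ≥ 0` and every `k : ℕ`, `ν^k/k! ≤ exp(ν - min(ν,1)/2)`,
i.e. `e^{-ν} ν^k/k! ≤ e^{-min(ν,1)/2}` (`k = 0`: clear; `k ≥ 1`: `e·y ≤ e^y` at `y = ν/k` gives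
`ν^k ≤ e^ν (k/e)^k`, and `k! ≥ √(2πk)(k/e)^k ≥ e^{1/2}(k/e)^k` as `e ≤ 2π`). [folklore] -/
theorem urnBound_pow_div_factorial_le {ν : ℝ} (hν : 0 ≤ ν) (k : ℕ) :
    ν ^ k / (k ! : ℝ) ≤ Real.exp (ν - min ν 1 / 2) := by
  rcases Nat.eq_zero_or_pos k with rfl | hk
  · have h0 : 0 ≤ ν - min ν 1 / 2 := by have := min_le_left ν 1; linarith
    simpa using Real.one_le_exp h0
  have hkpos : (0 : ℝ) < k := by exact_mod_cast hk
  have hk1 : (1 : ℝ) ≤ k := by exact_mod_cast hk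
  have he : 0 < Real.exp 1 := Real.exp_pos 1
  -- `ν^k ≤ e^ν (k/e)^k` from the tangent-line bound `e·y ≤ e^y` at `y = ν/k`
  have h1 : ν ^ k ≤ Real.exp ν * ((k : ℝ) / Real.exp 1) ^ k := by
    have ht : Real.exp 1 * (ν / k) ≤ Real.exp (ν / k) := by
      have h := Real.add_one_le_exp (ν / k - 1)
      rw [show Real.exp (ν / k) = Real.exp 1 * Real.exp (ν / k - 1) by
        rw [← Real.exp_add]; ring_nf]
      exact mul_le_mul_of_nonneg_left (by linarith) he.le
    have h2 : ν ^ k = (Real.exp 1 * (ν / k)) ^ k * ((k : ℝ) / Real.exp 1) ^ k := by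
      rw [← mul_pow]; congr 1; field_simp
    have h3 : Real.exp ν = Real.exp (ν / k) ^ k := by
      rw [← Real.exp_nat_mul]; congr 1; field_simp
    rw [h2, h3]
    exact mul_le_mul_of_nonneg_right (pow_le_pow_left₀ (by positivity) ht k) (by positivity)
  -- `e^{1/2} ≤ √(2πk)` (`e < 2.72`, `π > 3`)
  have h2 : Real.exp (1 / 2) ≤ √(2 * π * k) := by
    apply Real.le_sqrt_of_sq_le
    have h3 : Real.exp 1 < 2.7182818286 := Real.exp_one_lt_d9
    have h4 : (3 : ℝ) < π := Real.pi_gt_three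
    norm_num at h3
    rw [← Real.exp_nat_mul]
    calc Real.exp ((2 : ℕ) * (1 / 2)) = Real.exp 1 := by norm_num
      _ ≤ 2 * π := by linarith
      _ ≤ 2 * π * k := le_mul_of_one_le_right (by positivity) hk1
  have h3 : Real.exp ν ≤ Real.exp (ν - min ν 1 / 2) * Real.exp (1 / 2) := by
    rw [← Real.exp_add]
    have := min_le_right ν 1
    exact Real.exp_le_exp.2 (by linarith)
  rw [div_le_iff₀ (by positivity : (0 : ℝ) < k !)]
  calc ν ^ k ≤ (Real.exp (ν - min ν 1 / 2) * Real.exp (1 / 2)) * ((k : ℝ) / Real.exp 1) ^ k :=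
        h1.trans (by gcongr)
    _ ≤ Real.exp (ν - min ν 1 / 2) * (√(2 * π * k) * ((k : ℝ) / Real.exp 1) ^ k) := by
        rw [mul_assoc]; gcongr
    _ ≤ Real.exp (ν - min ν 1 / 2) * k ! := by gcongr; exact Stirling.le_factorial_stirling k

/-- **Product of Poisson point probabilities.** For `0 ≤ ν_i ≤ Λ` (`i ∈ s`), `1 ≤ Λ` and any
exponents `e_i`: `∏_{i∈s} ν_i^{e_i}/e_i! ≤ exp((1 - 1/(2Λ)) Σ_{i∈s} ν_i)` (termwise
`ν^k/k! ≤ exp(ν - min(ν,1)/2)` and `min(ν,1) ≥ ν/Λ`). [folklore] -/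
theorem urnBound_prod_pow_div_factorial_le {ι : Type*} (s : Finset ι) (ν : ι → ℝ) (e : ι → ℕ)
    (Λ : ℝ) (hΛ : 1 ≤ Λ) (hν : ∀ i ∈ s, 0 ≤ ν i) (hνΛ : ∀ i ∈ s, ν i ≤ Λ) :
    ∏ i ∈ s, ν i ^ e i / ((e i)! : ℝ) ≤ Real.exp ((1 - 1 / (2 * Λ)) * ∑ i ∈ s, ν i) := by
  rw [Finset.mul_sum, Real.exp_sum]
  refine Finset.prod_le_prod (fun i hi => by have := hν i hi; positivity) (fun i hi => ?_)
  refine (urnBound_pow_div_factorial_le (hν i hi) (e i)).trans (Real.exp_le_exp.2 ?_)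
  have hΛpos : 0 < Λ := by linarith
  -- `ν/Λ ≤ min(ν,1)`
  have h : ν i / Λ ≤ min (ν i) 1 := by
    rw [le_min_iff, div_le_iff₀ hΛpos, div_le_iff₀ hΛpos]
    exact ⟨by nlinarith [hν i hi, hνΛ i hi], by linarith [hνΛ i hi]⟩
  rw [show (1 - 1 / (2 * Λ)) * ν i = ν i - (ν i / Λ) / 2 by field_simp]
  linarith

/-- **Upper Stirling bound** `b! ≤ e √b (b/e)^b = exp(1 + ½ log b - b)·b^b` for `b ≥ 1` (the
Stirling sequence `n!/(√(2n)(n/e)^n)` decreases from `e/√2` at `n = 1`: Mathlib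
`Stirling.stirlingSeq'_antitone`, `Stirling.stirlingSeq_one`). [folklore] -/
theorem urnBound_factorial_le_exp {b : ℕ} (hb : b ≠ 0) :
    ((b ! : ℕ) : ℝ) ≤ Real.exp (1 + Real.log b / 2 - b) * (b : ℝ) ^ b := by
  -- adapted from Literature/NumberTheory/LFunctions/SatheSelbergProofs.lean (factorial_le_stirling)
  obtain ⟨i, rfl⟩ : ∃ i, b = i + 1 := ⟨b - 1, by omega⟩
  have hanti := Stirling.stirlingSeq'_antitone (Nat.zero_le i)
  simp only [Function.comp_apply, Nat.succ_eq_add_one, zero_add, Stirling.stirlingSeq_one] at hanti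
  rw [Stirling.stirlingSeq, div_le_iff₀ (by positivity)] at hanti
  refine hanti.trans_eq ?_
  have hpos : (0 : ℝ) < ((i + 1 : ℕ) : ℝ) := by positivity
  rw [Real.sqrt_mul zero_le_two, Real.exp_sub, Real.exp_add, Real.exp_half, Real.exp_log hpos,
    div_pow, Real.exp_one_pow, Real.sqrt_eq_rpow, Real.sqrt_eq_rpow]
  field_simp

/-! ### Numerics in `n` -/

/-- The threshold `n₁(θ)`: for `θ < 2/3`, eventually (in `n : ℕ`) `64 ≤ n`, `4 ≤ n^{1-θ}`,
`128 ≤ n^{2-3θ}` and `256 log n ≤ n^{2-3θ}` (`log x = o(x^{2-3θ})`,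
Mathlib `isLittleO_log_rpow_atTop`). -/
theorem urnBound_eventually {θ : ℝ} (hθ' : θ < 2 / 3) :
    ∃ n₁ : ℕ, ∀ n : ℕ, n₁ ≤ n → (64 : ℝ) ≤ n ∧ (4 : ℝ) ≤ (n : ℝ) ^ (1 - θ) ∧
      (128 : ℝ) ≤ (n : ℝ) ^ (2 - 3 * θ) ∧ 256 * Real.log n ≤ (n : ℝ) ^ (2 - 3 * θ) := by
  have h1θ : 0 < 1 - θ := by linarith
  have hδ : 0 < 2 - 3 * θ := by linarith
  have E1 : ∀ᶠ x : ℝ in Filter.atTop, 64 ≤ x := Filter.eventually_ge_atTop 64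
  have E2 : ∀ᶠ x : ℝ in Filter.atTop, 4 ≤ x ^ (1 - θ) :=
    (tendsto_rpow_atTop h1θ).eventually_ge_atTop 4
  have E3 : ∀ᶠ x : ℝ in Filter.atTop, 128 ≤ x ^ (2 - 3 * θ) :=
    (tendsto_rpow_atTop hδ).eventually_ge_atTop 128
  have E4 : ∀ᶠ x : ℝ in Filter.atTop, ‖Real.log x‖ ≤ 1 / 256 * ‖x ^ (2 - 3 * θ)‖ :=
    (isLittleO_log_rpow_atTop hδ).bound (by norm_num)
  obtain ⟨n₁, hn₁⟩ := Filter.eventually_atTop.1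
    ((tendsto_natCast_atTop_atTop (R := ℝ)).eventually (E1.and (E2.and (E3.and E4))))
  refine ⟨n₁, fun n hn => ?_⟩
  obtain ⟨h1, h2, h3, h4⟩ := hn₁ n hn
  refine ⟨h1, h2, h3, ?_⟩
  have h5 : Real.log n ≤ ‖Real.log (n : ℝ)‖ := Real.le_norm_self _
  rw [Real.norm_of_nonneg (by positivity : (0 : ℝ) ≤ (n : ℝ) ^ (2 - 3 * θ))] at h4
  linarith

/-! ### Small rows -/

/-- SMALL ROWS (`8·A·b ≤ x`): `(∏_j c_j^{e_j}/e_j!)·b! ≤ (A b)^b ≤ (x/8)^b ≤ (e^{-T/16} M)^b`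
(`c_j ≤ A`, `Σ e_j = b`, `b! ≤ b^b`, `x/4 ≤ M`, `1/2 ≤ 1 - T/16 ≤ e^{-T/16}`). -/
theorem urnBound_small (x A T Mr : ℝ) (b : ℕ) (hA : 0 < A) (hT1 : T ≤ 1) (hx : 0 < x)
    (hM4 : x / 4 ≤ Mr) (J : Finset ℕ) (c e : ℕ → ℕ) (he : ∑ j ∈ J, e j = b)
    (hcA : ∀ j ∈ J, (c j : ℝ) ≤ A) (hsmall : 8 * A * b ≤ x) :
    (∏ j ∈ J, (c j : ℝ) ^ (e j) / ((e j)! : ℝ)) * (b ! : ℝ) ≤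
      Real.exp (-(T / 16 * (b : ℝ))) * Mr ^ b := by
  have hP : ∏ j ∈ J, (c j : ℝ) ^ (e j) / ((e j)! : ℝ) ≤ A ^ b := by
    rw [← he, ← Finset.prod_pow_eq_pow_sum]
    refine Finset.prod_le_prod (fun j _ => by positivity) (fun j hj => ?_)
    have hf : (1 : ℝ) ≤ (e j)! := by exact_mod_cast (e j).factorial_pos
    exact (div_le_self (by positivity) hf).trans (pow_le_pow_left₀ (by positivity) (hcA j hj) _)
  have hfac : ((b ! : ℕ) : ℝ) ≤ (b : ℝ) ^ b := by exact_mod_cast Nat.factorial_le_pow b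
  have h2 : A * b ≤ x / 8 := by linarith
  have hMr : 0 ≤ Mr := by linarith
  have h3 : x / 8 ≤ Real.exp (-(T / 16)) * Mr := by
    have hexp : 1 - T / 16 ≤ Real.exp (-(T / 16)) := by
      have := Real.add_one_le_exp (-(T / 16)); linarith
    calc x / 8 = 1 / 2 * (x / 4) := by ring
      _ ≤ (1 - T / 16) * Mr := mul_le_mul (by linarith) hM4 (by positivity) (by linarith)
      _ ≤ Real.exp (-(T / 16)) * Mr := mul_le_mul_of_nonneg_right hexp hMr
  have h4 : Real.exp (-(T / 16 * (b : ℝ))) = Real.exp (-(T / 16)) ^ b := by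
    rw [← Real.exp_nat_mul]; congr 1; ring
  calc (∏ j ∈ J, (c j : ℝ) ^ (e j) / ((e j)! : ℝ)) * (b ! : ℝ) ≤ (A * b) ^ b := by
        rw [mul_pow]; exact mul_le_mul hP hfac (by positivity) (by positivity)
    _ ≤ (x / 8) ^ b := pow_le_pow_left₀ (by positivity) h2 b
    _ ≤ (Real.exp (-(T / 16)) * Mr) ^ b := pow_le_pow_left₀ (by positivity) h3 b
    _ = Real.exp (-(T / 16 * (b : ℝ))) * Mr ^ b := by rw [h4, mul_pow]

/-! ### Large rows -/

/-- The exponent bookkeeping of the LARGE-ROW case: with `ρ = N/M ≥ 1`,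
`(1 - T/8)·bρ + 1 + ½ log b - b ≤ -Tb/16`, from `bρ - b = b(N-M)/M ≤ 4Ab/x ≤ Tb/32`
(`128 A ≤ xT`), `(T/8) b ≤ (T/8) bρ`, and `1 + ½ log b ≤ log x ≤ xT/(256 A) < Tb/32`
(`256 A log x ≤ xT`, `x < 8Ab`). -/
theorem urnBound_exponent (x A T Mr Nr br : ℝ) (hA : 0 < A) (hT : 0 < T)
    (h128 : 128 * A ≤ x * T) (h256 : 256 * A * Real.log x ≤ x * T) (hlog : 2 ≤ Real.log x)
    (hx : 0 < x) (hM4 : x / 4 ≤ Mr) (hMN : Mr ≤ Nr) (hNM : Nr - Mr ≤ br)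
    (hb1 : 1 ≤ br) (hbA : br ≤ A) (hbx : br ≤ x) (hlarge : x < 8 * A * br) :
    (1 - 1 / (2 * (4 / T))) * (br * Nr / Mr) + (1 + Real.log br / 2 - br) ≤
      -(T / 16 * br) := by
  have hMpos : 0 < Mr := by linarith
  have hb0 : 0 < br := by linarith
  obtain ⟨ρ, hρ⟩ : ∃ ρ : ℝ, ρ = Nr / Mr := ⟨_, rfl⟩
  have hρ1 : 1 ≤ ρ := by rw [hρ, le_div_iff₀ hMpos]; linarith
  rw [show 1 - 1 / (2 * (4 / T)) = 1 - T / 8 by field_simp; ring,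
    show br * Nr / Mr = br * ρ by rw [hρ, mul_div_assoc]]
  -- (a) `bρ - b = b(N-M)/M ≤ 4Ab/x ≤ Tb/32`
  have hac : br * ρ - br ≤ T * br / 32 := by
    rw [show br * ρ - br = br * (Nr - Mr) / Mr by rw [hρ]; field_simp]
    have h2 : br * (Nr - Mr) / Mr ≤ br * A / (x / 4) :=
      div_le_div₀ (by positivity) (mul_le_mul_of_nonneg_left (hNM.trans hbA) hb0.le)
        (by positivity) hM4
    have h3 : br * A / (x / 4) ≤ T * br / 32 := by
      rw [div_le_div_iff₀ (by positivity) (by norm_num)]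
      nlinarith [mul_le_mul_of_nonneg_left h128 hb0.le]
    exact h2.trans h3
  -- (b) `T b ≤ T bρ`
  have hb' : T * br ≤ T * (br * ρ) :=
    mul_le_mul_of_nonneg_left (by simpa using mul_le_mul_of_nonneg_left hρ1 hb0.le) hT.le
  -- (c) `1 + ½ log b ≤ log x ≤ Tb/32`
  have hde : 1 + Real.log br / 2 ≤ T * br / 32 := by
    have h1 : Real.log br ≤ Real.log x := Real.log_le_log hb0 hbx
    have h2 : x * T < 8 * A * br * T := mul_lt_mul_of_pos_right hlarge hT
    have h3 : A * (256 * Real.log x) ≤ A * (8 * T * br) := by nlinarith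
    have h4 : 256 * Real.log x ≤ 8 * T * br := le_of_mul_le_mul_left h3 hA
    linarith
  linarith [hac, hb', hde]

/-- LARGE ROWS (`x < 8·A·b`): with `ν_j = b c_j/M` (`0 ≤ ν_j ≤ 4/T`, `Σ ν_j = bN/M`),
`(∏_j c_j^{e_j}/e_j!)·b! = (∏_j ν_j^{e_j}/e_j!)(M/b)^b·b! ≤ exp((1 - T/8) bN/M)(M/b)^b ·
exp(1 + ½ log b - b) b^b ≤ exp(-Tb/16) M^b` (Poisson product bound, upper Stirling bound, and
`urnBound_exponent`). -/
theorem urnBound_large (x A T Mr : ℝ) (N b : ℕ) (hA : 0 < A) (hT : 0 < T) (hT1 : T ≤ 1)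
    (hAAT : A * A * T = x) (h128 : 128 * A ≤ x * T) (h256 : 256 * A * Real.log x ≤ x * T)
    (hlog : 2 ≤ Real.log x) (hx : 0 < x) (hM4 : x / 4 ≤ Mr) (hMN : Mr ≤ N)
    (hNM : (N : ℝ) - Mr ≤ b) (hbA : (b : ℝ) ≤ A) (hbx : (b : ℝ) ≤ x) (J : Finset ℕ)
    (c e : ℕ → ℕ) (hc : ∑ j ∈ J, c j = N) (he : ∑ j ∈ J, e j = b)
    (hcA : ∀ j ∈ J, (c j : ℝ) ≤ A) (hlarge : x < 8 * A * b) :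
    (∏ j ∈ J, (c j : ℝ) ^ (e j) / ((e j)! : ℝ)) * (b ! : ℝ) ≤
      Real.exp (-(T / 16 * (b : ℝ))) * Mr ^ b := by
  have hMpos : 0 < Mr := by linarith
  have hbpos : (0 : ℝ) < b := pos_of_mul_pos_right (hx.trans hlarge) (by positivity)
  have hb0 : b ≠ 0 := by rintro rfl; simp at hbpos
  -- the Poisson parameters `ν_j = b c_j / M`
  set ν : ℕ → ℝ := fun j => (b : ℝ) * c j / Mr with hν
  have hν0 : ∀ j ∈ J, 0 ≤ ν j := fun j _ => by positivity
  have hΛ1 : (1 : ℝ) ≤ 4 / T := by rw [le_div_iff₀ hT]; linarith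
  have hνΛ : ∀ j ∈ J, ν j ≤ 4 / T := by
    intro j hj
    have h1 : (b : ℝ) * c j ≤ A * A := mul_le_mul hbA (hcA j hj) (by positivity) hA.le
    simp only [hν]
    rw [div_le_div_iff₀ hMpos hT]
    nlinarith [mul_le_mul_of_nonneg_right h1 hT.le]
  have hνsum : ∑ j ∈ J, ν j = (b : ℝ) * N / Mr := by
    simp only [hν]
    rw [← Finset.sum_div, ← Finset.mul_sum]
    congr
    exact_mod_cast hc
  -- `P = (∏ ν^e/e!) · (M/b)^b`
  have hP : ∏ j ∈ J, (c j : ℝ) ^ (e j) / ((e j)! : ℝ) =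
      (∏ j ∈ J, ν j ^ (e j) / ((e j)! : ℝ)) * (Mr / b) ^ b := by
    have hP' : (Mr / b) ^ b = ∏ j ∈ J, (Mr / b) ^ (e j) := by
      rw [Finset.prod_pow_eq_pow_sum, he]
    rw [hP', ← Finset.prod_mul_distrib]
    refine Finset.prod_congr rfl (fun j _ => ?_)
    have h1 : (b : ℝ) * c j / Mr * (Mr / b) = c j := by field_simp
    simp only [hν]
    rw [div_mul_eq_mul_div, ← mul_pow, h1]
  -- Poisson product bound, upper Stirling bound, exponent bookkeeping
  have hprod : ∏ j ∈ J, ν j ^ (e j) / ((e j)! : ℝ) ≤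
      Real.exp ((1 - 1 / (2 * (4 / T))) * ((b : ℝ) * N / Mr)) :=
    hνsum ▸ urnBound_prod_pow_div_factorial_le J ν e (4 / T) hΛ1 hν0 hνΛ
  have hfac : ((b ! : ℕ) : ℝ) ≤ Real.exp (1 + Real.log b / 2 - b) * (b : ℝ) ^ b :=
    urnBound_factorial_le_exp hb0
  have hexp : (1 - 1 / (2 * (4 / T))) * ((b : ℝ) * N / Mr) + (1 + Real.log b / 2 - b) ≤
      -(T / 16 * (b : ℝ)) :=
    urnBound_exponent x A T Mr N b hA hT h128 h256 hlog hx hM4 hMN hNM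
      (by exact_mod_cast Nat.one_le_iff_ne_zero.2 hb0) hbA hbx hlarge
  have hbb : (b : ℝ) ^ b ≠ 0 := by positivity
  calc (∏ j ∈ J, (c j : ℝ) ^ (e j) / ((e j)! : ℝ)) * (b ! : ℝ)
      = (∏ j ∈ J, ν j ^ (e j) / ((e j)! : ℝ)) * (Mr / b) ^ b * (b ! : ℝ) := by rw [hP]
    _ ≤ Real.exp ((1 - 1 / (2 * (4 / T))) * ((b : ℝ) * N / Mr)) * (Mr / b) ^ b *
          (Real.exp (1 + Real.log b / 2 - b) * (b : ℝ) ^ b) :=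
        mul_le_mul (mul_le_mul_of_nonneg_right hprod (by positivity)) hfac (by positivity)
          (by positivity)
    _ = Real.exp ((1 - 1 / (2 * (4 / T))) * ((b : ℝ) * N / Mr) + (1 + Real.log b / 2 - b)) *
          Mr ^ b := by
        rw [Real.exp_add, div_pow]
        field_simp
    _ ≤ Real.exp (-(T / 16 * (b : ℝ))) * Mr ^ b := by gcongr

/-! ### Assembly -/

/-- The urn bound for a fixed good `n`, with `A = n^θ`, `T = n^{1-2θ}` abstracted to reals
subject to the numerics `A·A·T = n`, `A ≤ n/4`, `128 A ≤ nT`, `256 A log n ≤ nT`, `0 < T ≤ 1`: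
`∏_j C(c_j,e_j) ≤ ∏_j c_j^{e_j}/e_j!` (`Nat.choose_le_pow_div`), `M^b/b! ≤ C(N,b)` for
`M = N + 1 - b` (`Nat.pow_le_choose`), and `(∏_j c_j^{e_j}/e_j!)·b! ≤ e^{-Tb/16} M^b` by
`urnBound_small` / `urnBound_large`. -/
theorem urnBound_core (n : ℕ) (A T : ℝ) (hn : (64 : ℝ) ≤ n) (hA : 0 < A) (hT : 0 < T)
    (hT1 : T ≤ 1) (hAAT : A * A * T = n) (hA4 : A ≤ n / 4) (h128 : 128 * A ≤ n * T)
    (h256 : 256 * A * Real.log n ≤ n * T) (J : Finset ℕ) (c e : ℕ → ℕ) (N b : ℕ)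
    (hN : (n : ℝ) / 2 ≤ N) (hNn : N ≤ n) (hc : ∑ j ∈ J, c j = N) (he : ∑ j ∈ J, e j = b)
    (hb : (b : ℝ) ≤ A) (hcA : ∀ j ∈ J, (c j : ℝ) ≤ A) :
    ((∏ j ∈ J, (c j).choose (e j) : ℕ) : ℝ) ≤
      Real.exp (-(T / 16 * (b : ℝ))) * ((N.choose b : ℕ) : ℝ) := by
  have hn0 : (0 : ℝ) < n := by linarith
  have hNn' : (N : ℝ) ≤ n := by exact_mod_cast hNn
  have hbx : (b : ℝ) ≤ n := by linarith
  have hbN : b ≤ N + 1 := by exact_mod_cast (show (b : ℝ) ≤ N + 1 by linarith)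
  -- `M = N + 1 - b ≥ n/4`
  have hMcast : ((N + 1 - b : ℕ) : ℝ) = (N : ℝ) + 1 - b := by
    rw [Nat.cast_sub hbN, Nat.cast_add, Nat.cast_one]
  have hM4 : (n : ℝ) / 4 ≤ ((N + 1 - b : ℕ) : ℝ) := by rw [hMcast]; linarith
  -- `log n ≥ 2` (`e² < 2.72² < 64 ≤ n`)
  have hlog : 2 ≤ Real.log n := by
    rw [Real.le_log_iff_exp_le hn0]
    have h1 : Real.exp 1 < 2.7182818286 := Real.exp_one_lt_d9
    norm_num at h1
    rw [show Real.exp 2 = Real.exp 1 ^ 2 by rw [← Real.exp_nat_mul]; norm_num]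
    nlinarith [Real.exp_pos 1]
  -- the two elementary binomial bounds
  have hLHS : ((∏ j ∈ J, (c j).choose (e j) : ℕ) : ℝ) ≤
      ∏ j ∈ J, (c j : ℝ) ^ (e j) / ((e j)! : ℝ) := by
    rw [Nat.cast_prod]
    refine Finset.prod_le_prod (fun j _ => by positivity) (fun j _ => ?_)
    exact_mod_cast Nat.choose_le_pow_div (e j) (c j) (α := ℝ)
  have hRHS : ((N + 1 - b : ℕ) : ℝ) ^ b / (b ! : ℝ) ≤ (N.choose b : ℝ) := by
    exact_mod_cast Nat.pow_le_choose b N (α := ℝ)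
  -- the key estimate `P · b! ≤ e^{-Tb/16} M^b`
  have hkey : (∏ j ∈ J, (c j : ℝ) ^ (e j) / ((e j)! : ℝ)) * (b ! : ℝ) ≤
      Real.exp (-(T / 16 * (b : ℝ))) * ((N + 1 - b : ℕ) : ℝ) ^ b := by
    rcases le_or_gt (8 * A * b) (n : ℝ) with hsmall | hlarge
    · exact urnBound_small n A T _ b hA hT1 hn0 hM4 J c e he hcA hsmall
    · have hbpos : (0 : ℝ) < b := pos_of_mul_pos_right (hn0.trans hlarge) (by positivity)
      have hb1 : (1 : ℝ) ≤ b := by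
        exact_mod_cast Nat.one_le_iff_ne_zero.2 (by rintro rfl; simp at hbpos)
      have hMN : ((N + 1 - b : ℕ) : ℝ) ≤ N := by rw [hMcast]; linarith
      have hNM : (N : ℝ) - ((N + 1 - b : ℕ) : ℝ) ≤ b := by rw [hMcast]; linarith
      exact urnBound_large n A T _ N b hA hT hT1 hAAT h128 h256 hlog hn0 hM4 hMN hNM hb hbx
        J c e hc he hcA hlarge
  have hbf : (0 : ℝ) < b ! := by positivity
  calc ((∏ j ∈ J, (c j).choose (e j) : ℕ) : ℝ)
      ≤ ∏ j ∈ J, (c j : ℝ) ^ (e j) / ((e j)! : ℝ) := hLHS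
    _ = (∏ j ∈ J, (c j : ℝ) ^ (e j) / ((e j)! : ℝ)) * (b ! : ℝ) / (b ! : ℝ) := by
        field_simp
    _ ≤ Real.exp (-(T / 16 * (b : ℝ))) * ((N + 1 - b : ℕ) : ℝ) ^ b / (b ! : ℝ) := by
        gcongr
    _ = Real.exp (-(T / 16 * (b : ℝ))) * (((N + 1 - b : ℕ) : ℝ) ^ b / (b ! : ℝ)) := by ring
    _ ≤ Real.exp (-(T / 16 * (b : ℝ))) * (N.choose b : ℝ) := by gcongr

/-- **Stub `stub_urnBound` — one-row urn bound** (multivariate-hypergeometric anti-concentration).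
Fix `1/2 ≤ θ < 2/3`.  For `n ≥ n₁(θ)`: an urn of `N` balls, `n/2 ≤ N ≤ n`, split into colour
classes `c_j ≤ n^θ` (`j ∈ J`, `Σ c_j = N`), and a prescribed histogram `e_j` (`Σ e_j = b`,
`b ≤ n^θ`): the number of `b`-subsets realising the histogram, `∏_j C(c_j, e_j)`, is at most
`exp(-b·n^{1-2θ}/16)·C(N, b)`.  Proof: `urnBound_core` at `A = n^θ`, `T = n^{1-2θ}` with the
numerics of `urnBound_eventually` (`n ≥ 64`, `n^{1-θ} ≥ 4`, `n^{2-3θ} ≥ max(128, 256 log n)`). -/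
theorem stub_urnBound : ∀ θ : ℝ, 1 / 2 ≤ θ → θ < 2 / 3 → ∃ n₁ : ℕ, ∀ n : ℕ, n₁ ≤ n →
    ∀ (J : Finset ℕ) (c e : ℕ → ℕ) (N b : ℕ), (n : ℝ) / 2 ≤ (N : ℝ) → N ≤ n →
    (∑ j ∈ J, c j) = N → (∑ j ∈ J, e j) = b → ((b : ℕ) : ℝ) ≤ (n : ℝ) ^ θ →
    (∀ j ∈ J, ((c j : ℕ) : ℝ) ≤ (n : ℝ) ^ θ) →
    ((∏ j ∈ J, (c j).choose (e j) : ℕ) : ℝ) ≤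
      Real.exp (-((n : ℝ) ^ (1 - 2 * θ) / 16 * (b : ℝ))) * ((N.choose b : ℕ) : ℝ) := by
  intro θ hθ hθ'
  obtain ⟨n₁, hn₁⟩ := urnBound_eventually hθ'
  refine ⟨n₁, fun n hn J c e N b hN hNn hc he hb hcA => ?_⟩
  obtain ⟨h64, h4, h128, h256⟩ := hn₁ n hn
  have hn0 : (0 : ℝ) < n := by linarith
  have hA : (0 : ℝ) < (n : ℝ) ^ θ := Real.rpow_pos_of_pos hn0 θ
  have hT : (0 : ℝ) < (n : ℝ) ^ (1 - 2 * θ) := Real.rpow_pos_of_pos hn0 _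
  have hT1 : (n : ℝ) ^ (1 - 2 * θ) ≤ 1 :=
    Real.rpow_le_one_of_one_le_of_nonpos (by linarith) (by linarith)
  -- `n^θ · n^θ · n^{1-2θ} = n`, `n^θ · n^{1-θ} = n` and `n · n^{1-2θ} = n^θ · n^{2-3θ}`
  have hAAT : (n : ℝ) ^ θ * (n : ℝ) ^ θ * (n : ℝ) ^ (1 - 2 * θ) = n := by
    rw [← Real.rpow_add hn0, ← Real.rpow_add hn0, show θ + θ + (1 - 2 * θ) = 1 by ring,
      Real.rpow_one]
  have hA1 : (n : ℝ) ^ θ * (n : ℝ) ^ (1 - θ) = n := by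
    rw [← Real.rpow_add hn0, show θ + (1 - θ) = 1 by ring, Real.rpow_one]
  have hnT : (n : ℝ) * (n : ℝ) ^ (1 - 2 * θ) = (n : ℝ) ^ θ * (n : ℝ) ^ (2 - 3 * θ) := by
    rw [← Real.rpow_add hn0, show θ + (2 - 3 * θ) = 1 + (1 - 2 * θ) by ring, Real.rpow_add hn0,
      Real.rpow_one]
  have hA4 : (n : ℝ) ^ θ ≤ n / 4 := by
    rw [le_div_iff₀ (by norm_num : (0 : ℝ) < 4)]
    calc (n : ℝ) ^ θ * 4 ≤ (n : ℝ) ^ θ * (n : ℝ) ^ (1 - θ) := mul_le_mul_of_nonneg_left h4 hA.le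
      _ = n := hA1
  have h128' : 128 * (n : ℝ) ^ θ ≤ n * (n : ℝ) ^ (1 - 2 * θ) := by rw [hnT]; nlinarith
  have h256' : 256 * (n : ℝ) ^ θ * Real.log n ≤ n * (n : ℝ) ^ (1 - 2 * θ) := by
    rw [hnT]; nlinarith
  exact urnBound_core n _ _ h64 hA hT hT1 hAAT hA4 h128' h256' J c e N b hN hNn hc he hb hcA

end Summit.MatrixMultiplication.MatrixMultiplication.Theorems.GlobalBranch
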